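import Mathlib
import Summits.NavierStokesRegularity.NavierStokesRegularity.Theorems.FilamentSkeletonRssSkeletonJ1RLineDefs
import Summits.NavierStokesRegularity.NavierStokesRegularity.Theorems.FilamentSkeletonRssSkeletonJ1RReferenceInjectivityOfCore

/-!
# Crux `SkeletonJ1R` (stmt-NavierStokesRegularity-23610) · line `streamline_kantorovich_R` · RESHAPE 4′ glue:
# `ReferenceInjectivityL1` FOLLOWS FROM COLLAR-`C¹` CORE PINNING (`CorePinningL1`)

Lead `ns-fsr-lead-23610` g2 (text by tenure `ns-tenure-lcore` g31), 2026-08-29.  MODEL rung, NEGATIVE side of the ladder: statements about a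
HYPOTHETICAL filament-type blow-up skeleton; NS regularity is OPEN and nothing here proves it.

Reshape 4′ re-types the core pinning stub with the linearised switched defect measured in the COLLAR-`C¹` norm (`CorePinningL1`,
`ReferenceInjectivityL1` in `…SkeletonJ1RLineDefs` §5): tenure g31's edge-resonance computation (memo `L-core-EDGE-RESONANCE-tenure-g31.md`)
shows the sup-norm typing `CorePinningL` admits no Γ-uniform constant, while one integration by parts against a `C¹` collar bound defuses the
resonant edge pumping.  This file threads the defect function `Df` and its collar derivative bound through the LANDED far pinning
(`far_of_core_pos/neg` of `…ReferenceInjectivityOfCore`): verbatim the proof of `referenceInjectivityL_of_core` with `K ↦ 2K + 2`.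
-/

noncomputable section

namespace Summit.NavierStokesRegularity.NavierStokesRegularity.Theorems.SkeletonJ1RFrame

open Set Function Filter Real Topology
open Summit.NavierStokesRegularity.NavierStokesRegularity.Theorems.FilamentSkeletonRssSkeletonJ1GSplit (NearStraightJ1G StraightDatum)
open scoped InnerProductSpace

/-- RESHAPE glue for the repaired pair: `CorePinningL1 → ReferenceInjectivityL1` (`K ↦ 2K + 2`), verbatim the landed proof of
`referenceInjectivityL_of_core` with the defect function and its collar derivative bound threaded through to the core statement. -/
theorem referenceInjectivityL1_of_core (hcore : CorePinningL1) : ReferenceInjectivityL1 := by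
  intro N δd ρd Λd Rwd θd mw p t γ α s₀ hN hδ hρ hRw hθ hmw hSD hGP
  obtain ⟨Rb₁, hRb₁, hcoreRb⟩ := hcore N δd ρd Λd Rwd θd mw p t γ α s₀ hN hδ hρ hRw hθ hmw hSD hGP
  obtain ⟨ht, hsep, -, hparams, hwaist, -⟩ := hSD
  have hγ : ∀ j, γ j ≠ 0 := fun j => by
    have := (hparams.2.2 j).1; intro h0; rw [h0, abs_zero] at this; linarith
  set θd' := min θd 1 with hθd'
  have hθd'0 : 0 < θd' := lt_min hθ one_pos
  have hθd'1 : θd' ≤ 1 := min_le_right _ _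
  have hGP' : ∀ j k, j ≠ k → |inner ℝ (t j) (t k)| ≤ 1 - θd' := fun j k hjk =>
    (hGP j k hjk).trans (by linarith [min_le_left θd 1])
  obtain ⟨θ₁, hθ₁0, hθ₁h, hθ₁A⟩ := tiltBudget_exists θd' ρd (fun j => p j + s₀ j • t j) hθd'0 hρ
  obtain ⟨RbR, hRbR0, hrates⟩ := curvCeil_rates_all hN ρd p t s₀ γ α hρ hγ
  refine ⟨min Rb₁ (min 1 (min RbR (4 * θ₁))), lt_min hRb₁ (lt_min one_pos (lt_min hRbR0 (by positivity))), fun Rb hRb hRble => ?_⟩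
  have hRbRb₁ : Rb ≤ Rb₁ := hRble.trans (min_le_left _ _)
  have hRb1 : Rb ≤ 1 := hRble.trans ((min_le_right _ _).trans (min_le_left _ _))
  have hRbR : Rb ≤ RbR := hRble.trans ((min_le_right _ _).trans ((min_le_right _ _).trans (min_le_left _ _)))
  have hRbθ : Rb / 8 < θ₁ := by
    have : Rb ≤ 4 * θ₁ := hRble.trans ((min_le_right _ _).trans ((min_le_right _ _).trans (min_le_right _ _))); linarith
  obtain ⟨Γc, Kc, hKc, hcoreΓ⟩ := hcoreRb Rb hRb hRbRb₁
  obtain ⟨Γ₁, hΓ₁3, hΓrates⟩ := hrates Rb hRb hRbR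
  refine ⟨max Γc (max Γ₁ (Real.exp (Rwd ^ 2 / Rb ^ 2))), 2 * Kc + 2, by positivity,
    fun Γ hΓ x M hx hframe Y B L Df hY hperp hB hDf hDfL hDf1 j τ => ?_⟩
  have hΓc : Γc ≤ Γ := (le_max_left _ _).trans hΓ
  have hΓ1 : Γ₁ ≤ Γ := ((le_max_left _ _).trans (le_max_right _ _)).trans hΓ
  have hΓw : Real.exp (Rwd ^ 2 / Rb ^ 2) ≤ Γ := ((le_max_right _ _).trans (le_max_right _ _)).trans hΓ
  have hΓ0 : 0 < Γ := by linarith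
  obtain ⟨hrate, -, hℓ⟩ := hΓrates Γ hΓ1
  have hcoreY := hcoreΓ Γ hΓc x M hx hframe Y B L Df hY hperp hB hDf hDfL hDf1
  have hD : ∀ j τ, ∃ D : EuclideanSpace ℝ (Fin 3),
      HasDerivAt (fun s : ℝ => swDefect Γ Rb γ α M (fun k σ => x k σ + s • Y k σ) j τ) D 0 ∧ ‖D‖ ≤ L :=
    fun j τ => ⟨Df j τ, hDf j τ, hDfL j τ⟩
  have hL0 : 0 ≤ L := by obtain ⟨D, -, hDL⟩ := hD j τ; exact (norm_nonneg D).trans hDL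
  by_cases hcoreτ : ‖x j τ‖ ^ 2 ≤ 2 * (Rb * Real.sqrt (Γ * Real.log Γ)) ^ 2
  · have := hcoreY j τ hcoreτ
    nlinarith
  · push Not at hcoreτ
    obtain ⟨⟨hbase, htiltR, -, -⟩, hM⟩ := hframe
    have hxj : ContDiff ℝ 2 (x j) := (hx j).1
    have hunit : ∀ s, ‖deriv (x j) s‖ = 1 := (hx j).2.1
    have htilt : ∀ s, ‖deriv (x j) s - t j‖ ≤ 1 / 2 := fun s => (htiltR j s).trans (by linarith)
    have hYj : ContDiff ℝ 1 (Y j) := (hY j).of_le (by norm_num)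
    have hρΓ : 0 < ρd * Real.sqrt Γ := by have := Real.sqrt_pos.2 hΓ0; positivity
    have hκ : ∀ s, |s| * ‖iteratedDeriv 2 (x j) s‖ ≤ (1:ℝ) / 7 := fun s =>
      (hx.abs_mul_curvature_le ht hθd'0 hθd'1 hGP' hρ hsep hΓ0 hℓ j hRbθ hθ₁h (fun k hk => hθ₁A j k) (hrate j) s).trans (by linarith)
    have h0 : ‖x j 0‖ ^ 2 ≤ 2 * (Rb * Real.sqrt (Γ * Real.log Γ)) ^ 2 := by
      rw [(hx j).2.2.1]
      unfold waistPt
      have hlog : Rwd ^ 2 / Rb ^ 2 ≤ Real.log Γ := by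
        have := Real.log_le_log (Real.exp_pos _) hΓw
        rwa [Real.log_exp] at this
      have hlog0 : 0 ≤ Real.log Γ := le_trans (by positivity) hlog
      have hq : ‖p j + s₀ j • t j‖ ≤ Rwd := hwaist j
      have hq2 : ‖p j + s₀ j • t j‖ ^ 2 ≤ Rb ^ 2 * Real.log Γ := by
        have h1 : ‖p j + s₀ j • t j‖ ^ 2 ≤ Rwd ^ 2 := pow_le_pow_left₀ (norm_nonneg _) hq 2
        have h2 : Rwd ^ 2 ≤ Rb ^ 2 * Real.log Γ := by
          rw [div_le_iff₀ (by positivity)] at hlog; linarith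
        linarith
      rw [norm_smul, Real.norm_of_nonneg (Real.sqrt_nonneg _)]
      simp only [mul_pow, Real.sq_sqrt hΓ0.le, Real.sq_sqrt (by positivity : 0 ≤ Γ * Real.log Γ)]
      nlinarith [mul_le_mul_of_nonneg_left hq2 hΓ0.le, hΓ0.le, hlog0]
    have hDj : ∀ s, ∃ D : EuclideanSpace ℝ (Fin 3),
        HasDerivAt (fun r : ℝ => swDefect Γ Rb γ α M (fun k σ => x k σ + r • Y k σ) j s) D 0 ∧ ‖D‖ ≤ L := fun s => hD j s
    have hτ0 : τ ≠ 0 := by rintro rfl; exact absurd h0 (not_le.2 hcoreτ)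
    rcases hτ0.lt_or_gt with hneg | hpos
    · have h := far_of_core_neg (C := Kc * L) hM one_pos hρΓ hℓ j hxj hunit (ht j) htilt hYj (hperp j) hκ hDj h0 hneg hcoreτ
        (fun s _ hs => hcoreY j s hs)
      linarith
    · have h := far_of_core_pos (C := Kc * L) hM one_pos hρΓ hℓ j hxj hunit (ht j) htilt hYj (hperp j) hκ hDj h0 hpos hcoreτ
        (fun s _ hs => hcoreY j s hs)
      linarith


/-- The repaired closing feeds `FineFixedPointL` (unchanged output shape): `KantorovichClosingBL1` plus F1, F2-B, F2-d and L′. -/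
theorem fineFixedPointL_of_BL1 (hK : KantorovichClosingBL1) (hF1 : LiaFrameExistsL) (hF2 : LiaDefectBL) (hF2d : LiaDefectDerivBL)
    (hL : ReferenceInjectivityL1) : FineFixedPointL := hK hF1 hF2 hF2d hL

end Summit.NavierStokesRegularity.NavierStokesRegularity.Theorems.SkeletonJ1RFrame

end
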